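import Summits.Ventures.Crystal3D.StickySpheres.SmallContactInduction
import Summits.Ventures.Crystal3D.StickySpheres.RadiusOne
import HarnessLib

/-!
# Cubic chunks of the face-centred cubic lattice: `C(m³) ≥ 6(m-2)³`, and monotonicity of `C`

HONEST FRAMING. Part of the venture `Summits/Ventures/Crystal3D` (cell `pub-crystal3d`). This file
PROVES the construction side of the energetic sticky-crystallization statement: (i) `C(N)` is
monotone in `N` (`maxContacts_mono`: dock a far-away ball), and (ii) the `m³` points
`n₀b₁ + n₁b₂ + n₂b₃`, `0 ≤ nₖ < m`, `b = (1,1,0), (1,0,1), (0,1,1)`, scaled by `1/√2`, form a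
unit packing (`isUnitPacking_fccChunk`; separation by the parity lemma
`two_le_sqNormInt_of_even`) in which each of the `≥ (m-2)³` interior balls touches twelve others
(`twelve_le_coordination_of_interior`, the twelve offsets checked by `decide`), whence
`six_mul_cube_le_maxContacts : 6 (m-2)³ ≤ C(m³)`. The limit `C(N)/N → 6` is drawn in
`StickySpheres/Asymptotics.lean`. Nothing is claimed about the surface term or about positions of
ground states.
-/

noncomputable section

open scoped BigOperators Topology
open Finset Filter

namespace Summit.Ventures.Crystal3D

open Literature.Geometry.DiscreteGeometry (sqNormInt)
open Literature.Barriers.AtomisticToContinuum (intConfig)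

/-! ## Monotonicity of `C(N)` -/

/-- `C(N) ≤ C(N+1)`: dock one more ball far away from a maximal packing. -/
theorem maxContacts_le_succ (N : ℕ) : maxContacts 3 N ≤ maxContacts 3 (N + 1) := by
  obtain ⟨x, hx, hxe⟩ := exists_numContacts_eq_maxContacts (d := 3) (by norm_num) N
  set R : ℝ := 1 + ∑ i, ‖x i‖ with hR
  set q : EuclideanSpace ℝ (Fin 3) := EuclideanSpace.single 0 R with hq
  have hR0 : 0 ≤ R := by
    have : 0 ≤ ∑ i, ‖x i‖ := sum_nonneg fun i _ => norm_nonneg _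
    linarith
  have hqn : ‖q‖ = R := by
    rw [hq, PiLp.norm_single, Real.norm_eq_abs, abs_of_nonneg hR0]
  have hfar : ∀ i, 1 ≤ dist q (x i) := by
    intro i
    have h1 : ‖x i‖ ≤ ∑ j, ‖x j‖ := single_le_sum (fun j _ => norm_nonneg (x j)) (mem_univ i)
    calc (1 : ℝ) ≤ ‖q‖ - ‖x i‖ := by rw [hqn, hR]; linarith
      _ ≤ dist q (x i) := by rw [dist_eq_norm]; exact norm_sub_norm_le q (x i)
  have hP := isUnitPacking_dock hx hfar
  have hC : numContacts x ≤ numContacts (dock x q) := by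
    rw [numContacts_dock]; exact Nat.le_add_left _ _
  rw [← hxe]
  exact hC.trans (numContacts_le_maxContacts hP)

/-- `C` is monotone in the number of balls. -/
theorem maxContacts_mono {N M : ℕ} (h : N ≤ M) : maxContacts 3 N ≤ maxContacts 3 M := by
  induction h with
  | refl => exact le_rfl
  | step _ ih => exact ih.trans (maxContacts_le_succ _)

/-! ## Cubic chunks of the face-centred cubic lattice -/

/-- The fcc lattice point with coefficients `n`: `n₀(1,1,0) + n₁(1,0,1) + n₂(0,1,1)`. -/
def fccPoint (n : Fin 3 → ℤ) : Fin 3 → ℤ :=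
  ![n 0 + n 1, n 0 + n 2, n 1 + n 2]

/-- `fccPoint` is additive: differences of points are points of differences. -/
theorem fccPoint_sub (a b : Fin 3 → ℤ) : fccPoint a - fccPoint b = fccPoint (a - b) := by
  ext k; fin_cases k <;> simp [fccPoint] <;> ring

/-- `fccPoint (-d) = -fccPoint d`. -/
theorem fccPoint_neg (d : Fin 3 → ℤ) : fccPoint (-d) = -fccPoint d := by
  ext k; fin_cases k <;> simp [fccPoint] <;> ring

/-- `fccPoint` is injective (the basis has determinant `-2 ≠ 0`). -/
theorem fccPoint_eq_zero {d : Fin 3 → ℤ} (h : fccPoint d = 0) : d = 0 := by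
  have h0 := congrFun h 0
  have h1 := congrFun h 1
  have h2 := congrFun h 2
  simp [fccPoint] at h0 h1 h2
  ext k; fin_cases k <;> simp <;> omega

/-- fcc points have even coordinate sum. -/
theorem fccPoint_sum_even (d : Fin 3 → ℤ) :
    fccPoint d 0 + fccPoint d 1 + fccPoint d 2 = 2 * (d 0 + d 1 + d 2) := by
  simp [fccPoint]; ring

/-- `sqNormInt` is invariant under negation. -/
theorem sqNormInt_neg (v : Fin 3 → ℤ) : sqNormInt (-v) = sqNormInt v := by
  simp [sqNormInt]

/-- A non-zero integer vector with even coordinate sum has squared norm `≥ 2` (squared norm and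
coordinate sum have the same parity, and a non-zero vector has squared norm `≥ 1`). -/
theorem two_le_sqNormInt_of_even {v : Fin 3 → ℤ} (hv : v ≠ 0)
    (he : 2 ∣ v 0 + v 1 + v 2) : 2 ≤ sqNormInt v := by
  have hpar : 2 ∣ sqNormInt v - (v 0 + v 1 + v 2) := by
    have e0 : Even (v 0 * (v 0 - 1)) := by
      have := Int.even_mul_succ_self (v 0 - 1); rw [sub_add_cancel] at this
      simpa [mul_comm] using this
    have e1 : Even (v 1 * (v 1 - 1)) := by
      have := Int.even_mul_succ_self (v 1 - 1); rw [sub_add_cancel] at this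
      simpa [mul_comm] using this
    have e2 : Even (v 2 * (v 2 - 1)) := by
      have := Int.even_mul_succ_self (v 2 - 1); rw [sub_add_cancel] at this
      simpa [mul_comm] using this
    have hsum : sqNormInt v - (v 0 + v 1 + v 2) =
        v 0 * (v 0 - 1) + v 1 * (v 1 - 1) + v 2 * (v 2 - 1) := by
      simp only [sqNormInt]; ring
    rw [hsum]
    exact ((e0.add e1).add e2).two_dvd
  have hdvd : 2 ∣ sqNormInt v := by
    have := dvd_add hpar he
    simpa using this
  have hpos : 1 ≤ sqNormInt v := by
    -- otherwise every square vanishes and `v = 0`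
    by_contra hlt
    have hlt' : v 0 ^ 2 + v 1 ^ 2 + v 2 ^ 2 < 1 := by
      have := not_le.1 hlt; simpa [sqNormInt] using this
    have h0 : v 0 ^ 2 = 0 := by nlinarith [sq_nonneg (v 0), sq_nonneg (v 1), sq_nonneg (v 2)]
    have h1 : v 1 ^ 2 = 0 := by nlinarith [sq_nonneg (v 0), sq_nonneg (v 1), sq_nonneg (v 2)]
    have h2 : v 2 ^ 2 = 0 := by nlinarith [sq_nonneg (v 0), sq_nonneg (v 1), sq_nonneg (v 2)]
    have e0 : v 0 = 0 := (pow_eq_zero_iff two_ne_zero).1 h0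
    have e1 : v 1 = 0 := (pow_eq_zero_iff two_ne_zero).1 h1
    have e2 : v 2 = 0 := (pow_eq_zero_iff two_ne_zero).1 h2
    apply hv
    funext k
    fin_cases k
    · exact e0
    · exact e1
    · exact e2
  omega

variable (m : ℕ)

/-- The coefficient vector (in `ℤ³`, entries in `[0, m)`) of an index `i : Fin (m³)`. -/
def coeff (i : Fin (m ^ 3)) : Fin 3 → ℤ :=
  fun k => ((finFunctionFinEquiv.symm i : Fin 3 → Fin m) k : ℕ)

/-- `coeff` is injective. -/
theorem coeff_injective : Function.Injective (coeff m) := by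
  intro i j h
  apply finFunctionFinEquiv.symm.injective
  funext k
  have := congrFun h k
  simp only [coeff, Nat.cast_inj] at this
  exact Fin.ext this

/-- Coefficients lie in `[0, m)`. -/
theorem coeff_bounds (i : Fin (m ^ 3)) (k : Fin 3) : 0 ≤ coeff m i k ∧ coeff m i k < m := by
  simp only [coeff]
  exact ⟨by positivity, by exact_mod_cast ((finFunctionFinEquiv.symm i : Fin 3 → Fin m) k).isLt⟩

/-- The index with prescribed coefficient vector `w ∈ [0, m)³`. -/
def idxOf (w : Fin 3 → ℤ) (hw : ∀ k, 0 ≤ w k ∧ w k < m) : Fin (m ^ 3) :=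
  finFunctionFinEquiv fun k => ⟨(w k).toNat, by have := hw k; omega⟩

/-- `coeff (idxOf w) = w`. -/
theorem coeff_idxOf (w : Fin 3 → ℤ) (hw : ∀ k, 0 ≤ w k ∧ w k < m) :
    coeff m (idxOf m w hw) = w := by
  funext k
  simp only [coeff, idxOf, Equiv.symm_apply_apply]
  exact Int.toNat_of_nonneg (hw k).1

/-- Integer model of the fcc chunk: index `i ↦ fccPoint (coeff i)`. -/
def fccChunkInt (i : Fin (m ^ 3)) : Fin 3 → ℤ :=
  fccPoint (coeff m i)

/-- **The fcc chunk** of `m³` balls (diameter `1`): the integer model scaled by `1/√2`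
(contact at integer squared distance `2`; `(2 : ℕ)` to match the tree's `intConfig` lemmas). -/
def fccChunk : Fin (m ^ 3) → EuclideanSpace ℝ (Fin 3) :=
  intConfig (fccChunkInt m) (1 / Real.sqrt (2 : ℕ))

/-- Distinct balls of the chunk are at integer squared distance `≥ 2`. -/
theorem sep_fccChunk : ∀ i j : Fin (m ^ 3), i ≠ j →
    (2 : ℤ) ≤ sqNormInt (fccChunkInt m i - fccChunkInt m j) := by
  intro i j hij
  rw [fccChunkInt, fccChunkInt, fccPoint_sub]
  refine two_le_sqNormInt_of_even ?_ ?_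
  · intro h
    have h0 := fccPoint_eq_zero h
    exact hij (coeff_injective m (sub_eq_zero.1 h0))
  · exact ⟨_, fccPoint_sum_even _⟩

/-- The fcc chunk is a unit packing. -/
theorem isUnitPacking_fccChunk : IsUnitPacking (fccChunk m) :=
  isUnitPacking_intConfig (fccChunkInt m) (by norm_num) (by exact_mod_cast sep_fccChunk m)

/-- The twelve coefficient offsets of the nearest neighbours in the fcc lattice
(`±b₁, ±b₂, ±b₃, ±(b₁-b₂), ±(b₁-b₃), ±(b₂-b₃)` in coefficients). -/
def fccOffsets : Finset (Fin 3 → ℤ) :=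
  {![1, 0, 0], ![-1, 0, 0], ![0, 1, 0], ![0, -1, 0], ![0, 0, 1], ![0, 0, -1],
    ![1, -1, 0], ![-1, 1, 0], ![1, 0, -1], ![-1, 0, 1], ![0, 1, -1], ![0, -1, 1]}

/-- There are twelve offsets. -/
theorem card_fccOffsets : fccOffsets.card = 12 := by decide

/-- Each offset is a contact vector: `|fccPoint δ|² = 2`. -/
theorem sqNormInt_fccOffsets : ∀ δ ∈ fccOffsets, sqNormInt (fccPoint δ) = 2 := by decide

/-- Offsets have entries in `{-1, 0, 1}`. -/
theorem fccOffsets_bounds : ∀ δ ∈ fccOffsets, ∀ k : Fin 3, -1 ≤ δ k ∧ δ k ≤ 1 := by decide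

/-- Offsets are non-zero. -/
theorem fccOffsets_ne_zero : ∀ δ ∈ fccOffsets, δ ≠ 0 := by decide

variable {m}

/-- An index is **interior** if all its coefficients lie in `[1, m-2]`. -/
def IsInterior (i : Fin (m ^ 3)) : Prop :=
  ∀ k : Fin 3, 1 ≤ coeff m i k ∧ coeff m i k + 2 ≤ m

/-- The neighbour of an interior index in the direction of an offset (junk `i` otherwise). -/
def nbIdx (i : Fin (m ^ 3)) (δ : Fin 3 → ℤ) : Fin (m ^ 3) :=
  if h : ∀ k, 0 ≤ coeff m i k + δ k ∧ coeff m i k + δ k < m then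
    idxOf m (fun k => coeff m i k + δ k) h else i

/-- For an interior index and an offset, the neighbour has the shifted coefficients. -/
theorem coeff_nbIdx {i : Fin (m ^ 3)} (hi : IsInterior i) {δ : Fin 3 → ℤ} (hδ : δ ∈ fccOffsets) :
    coeff m (nbIdx i δ) = fun k => coeff m i k + δ k := by
  have h : ∀ k, 0 ≤ coeff m i k + δ k ∧ coeff m i k + δ k < m := by
    intro k
    have := hi k; have := fccOffsets_bounds δ hδ k
    omega
  rw [nbIdx, dif_pos h, coeff_idxOf]

/-- The neighbour in an offset direction is a contact neighbour in the packing. -/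
theorem nbIdx_mem_contactNeighbors {i : Fin (m ^ 3)} (hi : IsInterior i) {δ : Fin 3 → ℤ}
    (hδ : δ ∈ fccOffsets) : nbIdx i δ ∈ contactNeighbors (fccChunk m) i := by
  rw [mem_contactNeighbors]
  have hc := coeff_nbIdx hi hδ
  refine ⟨?_, ?_⟩
  · intro h
    have h' := congrArg (coeff m) h
    rw [hc] at h'
    apply fccOffsets_ne_zero δ hδ
    funext k
    have hk' : coeff m i k + δ k = coeff m i k := congrFun h' k
    have hk : δ k = 0 := by linarith
    simpa using hk
  · rw [fccChunk, dist_intConfig_inv_sqrt (fccChunkInt m) (by norm_num : 0 < 2)]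
    have hdiff : fccChunkInt m i - fccChunkInt m (nbIdx i δ) = fccPoint (-δ) := by
      rw [fccChunkInt, fccChunkInt, fccPoint_sub, hc]
      congr 1
      funext k
      simp
    rw [hdiff, fccPoint_neg, sqNormInt_neg, sqNormInt_fccOffsets δ hδ]
    norm_num

/-- Distinct offsets give distinct neighbours. -/
theorem nbIdx_injOn {i : Fin (m ^ 3)} (hi : IsInterior i) :
    Set.InjOn (nbIdx i) ↑fccOffsets := by
  intro δ hδ δ' hδ' h
  have h1 := coeff_nbIdx hi hδ
  have h2 := coeff_nbIdx hi hδ'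
  rw [h] at h1
  rw [h1] at h2
  funext k
  have hk : coeff m i k + δ k = coeff m i k + δ' k := congrFun h2 k
  linarith

/-- **Interior balls have twelve contacts** (at least; exactly, by the kissing number). -/
theorem twelve_le_coordination_of_interior {i : Fin (m ^ 3)} (hi : IsInterior i) :
    12 ≤ coordination (fccChunk m) i := by
  rw [← card_fccOffsets, coordination]
  exact card_le_card_of_injOn (nbIdx i) (fun δ hδ => nbIdx_mem_contactNeighbors hi hδ)
    (nbIdx_injOn hi)

/-- The interior indices. -/
def interiorIdx (m : ℕ) : Finset (Fin (m ^ 3)) := by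
  classical exact univ.filter fun i => IsInterior i

/-- There are at least `(m-2)³` interior indices (shift `[0, m-2)³` by one). -/
theorem cube_le_card_interiorIdx (m : ℕ) : (m - 2) ^ 3 ≤ (interiorIdx m).card := by
  classical
  -- the injection `n ↦ idxOf (n + 1)` from `Fin 3 → Fin (m - 2)`
  have hb : ∀ n : Fin 3 → Fin (m - 2), ∀ k, 0 ≤ ((n k : ℕ) : ℤ) + 1 ∧ ((n k : ℕ) : ℤ) + 1 < m := by
    intro n k
    have := (n k).isLt
    omega
  let g : (Fin 3 → Fin (m - 2)) → Fin (m ^ 3) := fun n => idxOf m (fun k => ((n k : ℕ) : ℤ) + 1) (hb n)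
  have hg_inj : Function.Injective g := by
    intro n n' h
    have h' := congrArg (coeff m) h
    simp only [g, coeff_idxOf] at h'
    funext k
    have := congrFun h' k
    exact Fin.ext (by exact_mod_cast (by linarith : ((n k : ℕ) : ℤ) = ((n' k : ℕ) : ℤ)))
  have hg_mem : ∀ n, g n ∈ interiorIdx m := by
    intro n
    simp only [interiorIdx, mem_filter, mem_univ, true_and, IsInterior, g, coeff_idxOf]
    intro k
    have := (n k).isLt
    omega
  calc (m - 2) ^ 3 = Fintype.card (Fin 3 → Fin (m - 2)) := by simp
    _ = (univ.image g).card := (card_image_of_injective _ hg_inj).symm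
    _ ≤ (interiorIdx m).card := card_le_card fun i hi => by
        obtain ⟨n, -, rfl⟩ := mem_image.1 hi; exact hg_mem n

/-- **The fcc chunk of `m³` balls has at least `6(m-2)³` contacts.** -/
theorem six_mul_cube_le_numContacts_fccChunk (m : ℕ) :
    6 * (m - 2) ^ 3 ≤ numContacts (fccChunk m) := by
  classical
  have h2 : 2 * numContacts (fccChunk m) = ∑ i, coordination (fccChunk m) i :=
    (sum_coordination_eq _).symm
  have hsum : 12 * (interiorIdx m).card ≤ ∑ i, coordination (fccChunk m) i := by
    calc 12 * (interiorIdx m).card = ∑ _i ∈ interiorIdx m, 12 := by simp [mul_comm]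
      _ ≤ ∑ i ∈ interiorIdx m, coordination (fccChunk m) i :=
          sum_le_sum fun i hi => twelve_le_coordination_of_interior
            (by simpa [interiorIdx] using hi)
      _ ≤ ∑ i, coordination (fccChunk m) i :=
          sum_le_sum_of_subset_of_nonneg (subset_univ _) fun _ _ _ => Nat.zero_le _
  have hint := cube_le_card_interiorIdx m
  omega

/-- **`C(m³) ≥ 6 (m-2)³`.** -/
theorem six_mul_cube_le_maxContacts (m : ℕ) : 6 * (m - 2) ^ 3 ≤ maxContacts 3 (m ^ 3) :=
  (six_mul_cube_le_numContacts_fccChunk m).trans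
    (numContacts_le_maxContacts (isUnitPacking_fccChunk m))

end Summit.Ventures.Crystal3D

end
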